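import Literature.NumberTheory.NumberFields.CyclicCubicField1339A
import Mathlib.NumberTheory.NumberField.ClassNumber
import HarnessLib

/-!
# The cyclic cubic field of conductor `1339` (`2` split): homomorphisms by images, Dedekind–Kummer away from `14`, the prime ideals, `d_K = 1339²`, Minkowski bound

Second file on `K = K' = ℚ(θ)`, `θ³ + θ² - 446θ + 248 = 0` (`CyclicCubicField1339A.lean`:
`𝓞 K = ℤ ⊕ ℤθ ⊕ ℤw`, `w = (θ² + 9θ + 4)/14`). It prepares the class-group certificate (exponent `3`)
and the `2`-descent of `480a1` over `K`. Everything is PROVED: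

* ring homomorphisms `𝓞 K → S` by images `t, v` of `θ, w` satisfying the three relations of the
  integral basis (`ringHomOfImages`, `exists_ringHom_apply`);
* `14 ∈ 𝔣_θ` and the exponent of `θ` is divisible only by `2, 7`, so **Dedekind–Kummer holds at
  every `p ∉ {2, 7}`** (`exists_factor_of_mem_primesOver`): `3, 5` are inert (`span_inert`), and at a
  totally ramified `p` (`f' ≡ (X - m)³`) the prime above `p` is the explicit one (`eq_P_of_cube`);
* **the prime ideals `𝔭 = ker(ψ : 𝓞 K → ℤ/p)`, `ψ(θ) = t`, `ψ(w) = v`** for an admissible pair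
  `(t, v) mod p` (`P p t v h`): maximal, norm `p`, decidable membership; distinctness; at a SPLIT
  prime (including `2` and `7`, where Dedekind–Kummer is not available) the three listed primes are
  ALL the primes above `p` because their product is `(p)` (`eq_of_mem_primesOver_split`);
* certified factorisations `(x) = 𝔭₁𝔭₂𝔭₃` from memberships and the integer norm form `normForm`
  on `1, θ, w`;
* `d_K = 1792921 = 1339²` (`discr_eq`), `r₂ = 0`, `⌊M_K⌋ ≤ 297` and the Minkowski lemma.

## References

* D. A. Marcus, *Number Fields*, 2nd ed. (2018), Ch. 3, Thm. 27; Ch. 5, Thm. 37. [cite: Marcus2018, Ch. 5, Thm. 37]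
* T. Dokchitser, V. Dokchitser, J. Number Theory 131 (2011) 1833–1839, proof of Thm. 2.
  [DokchitserDokchitser2011RankModN]
-/

noncomputable section

open Polynomial NumberField Algebra Ideal
open scoped nonZeroDivisors

namespace Literature.NumberTheory.NumberFields

namespace CyclicCubic1339A

/-! ### Uniqueness of coordinates on `1, θ, w`; ring homomorphisms by images of `θ, w` -/

/-- Coordinates on `1, θ, w` are unique (`1, θ, θ²` is a `ℚ`-basis and `w = (θ² + 9θ + 4)/14`).
[folklore] -/
theorem coords_unique {a b c a' b' c' : ℤ}
    (h : (a : K) + (b : K) * θ + (c : K) * w = (a' : K) + (b' : K) * θ + (c' : K) * w) :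
    a = a' ∧ b = b' ∧ c = c' := by
  have hq : (((c - c') / 14 : ℚ) : K) * θ ^ 2 + (((b - b') + 9 * (c - c') / 14 : ℚ) : K) * θ +
      (((a - a') + 4 * (c - c') / 14 : ℚ) : K) = 0 := by
    rw [show w = (θ ^ 2 + 9 * θ + 4) / 14 from rfl] at h
    push_cast
    linear_combination h
  by_contra hne
  refine quadratic_ne_zero ?_ hq
  intro h0
  simp only [Prod.mk.injEq] at h0
  obtain ⟨h1, h2, h3⟩ := h0
  apply hne
  have hc : (c : ℚ) = c' := by linarith
  have hb : (b : ℚ) = b' := by rw [hc, sub_self, mul_zero, zero_div, add_zero] at h2; linarith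
  have ha : (a : ℚ) = a' := by rw [hc, sub_self, mul_zero, zero_div, add_zero] at h3; linarith
  exact ⟨by exact_mod_cast ha, by exact_mod_cast hb, by exact_mod_cast hc⟩

/-- The coordinate vector of `z ∈ 𝓞 K` on the integral basis `1, θ, w`. [folklore] -/
def coord (z : 𝓞 K) : ℤ × ℤ × ℤ :=
  (Classical.choose (exists_int_coords z), Classical.choose (Classical.choose_spec (exists_int_coords z)),
    Classical.choose (Classical.choose_spec (Classical.choose_spec (exists_int_coords z))))

/-- `z = coord₀ + coord₁ θ + coord₂ w`. [folklore] -/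
theorem coord_spec (z : 𝓞 K) : z = (coord z).1 + (coord z).2.1 * θint + (coord z).2.2 * wint :=
  Classical.choose_spec (Classical.choose_spec (Classical.choose_spec (exists_int_coords z)))

/-- The coordinates of `a + bθ + cw` are `(a, b, c)`. [folklore] -/
theorem coord_eq_of_eq {z : 𝓞 K} {a b c : ℤ} (h : z = a + b * θint + c * wint) : coord z = (a, b, c) := by
  subst h
  have h1 := coord_spec ((a : 𝓞 K) + b * θint + c * wint)
  have h2 := congrArg (fun x : 𝓞 K => (x : K)) h1
  simp only [map_add, map_mul, map_intCast, coe_θint, coe_wint] at h2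
  obtain ⟨ha, hb, hc⟩ := coords_unique h2
  exact Prod.ext ha.symm (Prod.ext hb.symm hc.symm)

/-- **The product on coordinates** (from `θ² = -4 - 9θ + 14w`, `θw = -20 + 27θ + 8w`,
`w² = -32 + 14θ + 37w`). [folklore] -/
theorem mul_coords (a b c a' b' c' : ℤ) :
    ((a : 𝓞 K) + b * θint + c * wint) * (a' + b' * θint + c' * wint) =
      ((a * a' - 4 * (b * b') - 20 * (b * c' + c * b') - 32 * (c * c') : ℤ) : 𝓞 K) +
      ((a * b' + b * a' - 9 * (b * b') + 27 * (b * c' + c * b') + 14 * (c * c') : ℤ) : 𝓞 K) * θint +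
      ((a * c' + c * a' + 14 * (b * b') + 8 * (b * c' + c * b') + 37 * (c * c') : ℤ) : 𝓞 K) * wint := by
  obtain ⟨h1, h2, h3⟩ := int_basis_rel
  push_cast
  linear_combination (b * b' : 𝓞 K) * h1 + ((b : 𝓞 K) * c' + c * b') * h2 + (c * c' : 𝓞 K) * h3

/-- **Ring homomorphisms `𝓞 K → S` by images of `θ` and `w`.** Given `t, v ∈ S` satisfying the
relations of the integral basis, `a + bθ + cw ↦ a + bt + cv` is a ring homomorphism. [folklore] -/
def ringHomOfImages {S : Type*} [CommRing S] (t v : S) (h1 : t ^ 2 = -4 - 9 * t + 14 * v)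
    (h2 : t * v = -20 + 27 * t + 8 * v) (h3 : v ^ 2 = -32 + 14 * t + 37 * v) : 𝓞 K →+* S where
  toFun z := (coord z).1 + (coord z).2.1 * t + (coord z).2.2 * v
  map_one' := by
    rw [coord_eq_of_eq (z := 1) (a := 1) (b := 0) (c := 0) (by push_cast; ring)]
    push_cast; ring
  map_zero' := by
    rw [coord_eq_of_eq (z := 0) (a := 0) (b := 0) (c := 0) (by push_cast; ring)]
    push_cast; ring
  map_add' z z' := by
    have hz := coord_spec z
    have hz' := coord_spec z'
    have hzz : (((coord z).1 : 𝓞 K) + (coord z).2.1 * θint + (coord z).2.2 * wint) +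
        (((coord z').1 : 𝓞 K) + (coord z').2.1 * θint + (coord z').2.2 * wint) =
        (((coord z).1 + (coord z').1 : ℤ) : 𝓞 K) + (((coord z).2.1 + (coord z').2.1 : ℤ) : 𝓞 K) * θint +
          (((coord z).2.2 + (coord z').2.2 : ℤ) : 𝓞 K) * wint := by
      push_cast; ring
    rw [← hz, ← hz'] at hzz
    rw [coord_eq_of_eq hzz]
    push_cast; ring
  map_mul' z z' := by
    have hz := coord_spec z
    have hz' := coord_spec z'
    have hzz := mul_coords (coord z).1 (coord z).2.1 (coord z).2.2 (coord z').1 (coord z').2.1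
      (coord z').2.2
    rw [← hz, ← hz'] at hzz
    rw [coord_eq_of_eq hzz]
    push_cast
    linear_combination (-((coord z).2.1 : S) * (coord z').2.1) * h1 +
      (-(((coord z).2.1 : S) * (coord z').2.2 + (coord z).2.2 * (coord z').2.1)) * h2 +
      (-((coord z).2.2 : S) * (coord z').2.2) * h3

/-- `ringHomOfImages` sends `θ ↦ t`. [folklore] -/
theorem ringHomOfImages_θint {S : Type*} [CommRing S] (t v : S) (h1 : t ^ 2 = -4 - 9 * t + 14 * v)
    (h2 : t * v = -20 + 27 * t + 8 * v) (h3 : v ^ 2 = -32 + 14 * t + 37 * v) :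
    ringHomOfImages t v h1 h2 h3 θint = t := by
  show ((coord θint).1 : S) + (coord θint).2.1 * t + (coord θint).2.2 * v = t
  rw [coord_eq_of_eq (z := θint) (a := 0) (b := 1) (c := 0) (by push_cast; ring)]
  push_cast; ring

/-- `ringHomOfImages` sends `w ↦ v`. [folklore] -/
theorem ringHomOfImages_wint {S : Type*} [CommRing S] (t v : S) (h1 : t ^ 2 = -4 - 9 * t + 14 * v)
    (h2 : t * v = -20 + 27 * t + 8 * v) (h3 : v ^ 2 = -32 + 14 * t + 37 * v) :
    ringHomOfImages t v h1 h2 h3 wint = v := by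
  show ((coord wint).1 : S) + (coord wint).2.1 * t + (coord wint).2.2 * v = v
  rw [coord_eq_of_eq (z := wint) (a := 0) (b := 0) (c := 1) (by push_cast; ring)]
  push_cast; ring

/-- **Residue and reduction maps by images**: for `t, v ∈ S` satisfying the relations there is a ring
homomorphism `ψ : 𝓞 K → S` with `ψ θ = t`, `ψ w = v`. [folklore] -/
theorem exists_ringHom_apply {S : Type*} [CommRing S] (t v : S) (h1 : t ^ 2 = -4 - 9 * t + 14 * v)
    (h2 : t * v = -20 + 27 * t + 8 * v) (h3 : v ^ 2 = -32 + 14 * t + 37 * v) :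
    ∃ ψ : 𝓞 K →+* S, ψ θint = t ∧ ψ wint = v :=
  ⟨ringHomOfImages t v h1 h2 h3, ringHomOfImages_θint t v h1 h2 h3, ringHomOfImages_wint t v h1 h2 h3⟩

/-! ### The conductor of `θ` contains `14` and the exponent is divisible only by `2, 7` -/

/-- `14 ∈ 𝔣_θ`: `14 · 𝓞 K ⊆ ℤ[θ]` (`14(a + bθ + cw) = (14a + 4c) + (14b + 9c)θ + cθ²`). [folklore] -/
theorem fourteen_mem_conductor : (14 : 𝓞 K) ∈ conductor ℤ θint := by
  rw [mem_conductor_iff]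
  intro z
  obtain ⟨a, b, c, rfl⟩ := exists_int_coords z
  have h : (14 : 𝓞 K) * (a + b * θint + c * wint) =
      (14 * a + 4 * c : ℤ) + (14 * b + 9 * c : ℤ) * θint + c * θint ^ 2 := by
    rw [int_basis_rel.1]; push_cast; ring
  rw [h]
  refine Subalgebra.add_mem _ (Subalgebra.add_mem _ (Subalgebra.intCast_mem _ _)
    (Subalgebra.mul_mem _ (Subalgebra.intCast_mem _ _) (Algebra.self_mem_adjoin_singleton ℤ _))) ?_
  exact Subalgebra.mul_mem _ (Subalgebra.intCast_mem _ _)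
    (Subalgebra.pow_mem _ (Algebra.self_mem_adjoin_singleton ℤ _) 2)

/-- `θint` is a root of `f'` in `𝓞 K`. [folklore] -/
theorem aeval_θint : aeval θint cubicPoly = 0 := by
  apply IsFractionRing.injective (𝓞 K) K
  rw [map_zero, ← aeval_algebraMap_apply]
  exact aeval_θ_cubicPoly

/-- Elements of `ℤ[θ] ⊆ 𝓞 K` have integer coordinates on `1, θ, θ²`. [folklore] -/
theorem exists_coords_of_mem_adjoin_int {z : 𝓞 K} (hz : z ∈ Algebra.adjoin ℤ ({θint} : Set (𝓞 K))) :
    ∃ a b c : ℤ, z = (a : 𝓞 K) * θint ^ 2 + (b : 𝓞 K) * θint + c := by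
  rw [Algebra.adjoin_singleton_eq_range_aeval] at hz
  obtain ⟨q, rfl⟩ := hz
  set r := q %ₘ cubicPoly with hr
  have hmod : aeval θint r = aeval θint q := by
    rw [hr, Polynomial.modByMonic_eq_sub_mul_div q cubicPoly, map_sub, map_mul,
      aeval_θint, zero_mul, sub_zero]
  have hne : cubicPoly ≠ 1 :=
    ne_of_apply_ne natDegree (by rw [cubicPoly_natDegree, natDegree_one]; norm_num)
  have hdeg : r.natDegree < 3 := by
    rw [hr, ← cubicPoly_natDegree]
    exact natDegree_modByMonic_lt q cubicPoly_monic hne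
  have hsum : r = C (r.coeff 0) + C (r.coeff 1) * X + C (r.coeff 2) * X ^ 2 := by
    conv_lhs => rw [r.as_sum_range_C_mul_X_pow' hdeg]
    simp [Finset.sum_range_succ]
  refine ⟨r.coeff 2, r.coeff 1, r.coeff 0, ?_⟩
  change aeval θint q = _
  rw [← hmod]
  conv_lhs => rw [hsum]
  simp only [map_add, map_mul, map_pow, aeval_X, eq_intCast, map_intCast]
  ring

/-- **`14 ∣ d` for every natural number `d ∈ 𝔣_θ`**: `d w ∈ ℤ[θ]` forces `14 ∣ d` by comparing
the `θ²`-coordinates of `14 · d w = d(θ² + 9θ + 4)`. [folklore] -/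
theorem dvd_of_natCast_mem_conductor {d : ℕ} (hd : (d : 𝓞 K) ∈ conductor ℤ θint) : 14 ∣ d := by
  rw [mem_conductor_iff] at hd
  obtain ⟨a, b, c, habc⟩ := exists_coords_of_mem_adjoin_int (hd wint)
  have hK := congrArg (fun x : 𝓞 K => (x : K)) habc
  simp only [map_add, map_mul, map_pow, map_natCast, map_intCast, coe_θint, coe_wint] at hK
  rw [show w = (θ ^ 2 + 9 * θ + 4) / 14 from rfl] at hK
  have hq : (((14 * a - d) / 14 : ℚ) : K) * θ ^ 2 + (((14 * b - 9 * d) / 14 : ℚ) : K) * θ +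
      (((14 * c - 4 * d) / 14 : ℚ) : K) = 0 := by
    push_cast
    linear_combination -hK
  by_contra hne
  refine quadratic_ne_zero ?_ hq
  intro h0
  simp only [Prod.mk.injEq] at h0
  apply hne
  have h14 : (14 * a : ℚ) = d := by linarith [h0.1]
  have h14' : (14 * a : ℤ) = d := by exact_mod_cast h14
  exact Int.natCast_dvd_natCast.mp ⟨a, h14'.symm⟩

/-- **`p ∤ exponent(θ)` for every prime `p ∉ {2, 7}`** (the exponent is the least positive integer in
`𝔣_θ`; it divides… more precisely `14 ∣ exponent ≤ 14`, so the exponent is `14`). [folklore] -/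
theorem not_dvd_exponent {p : ℕ} (hp : p.Prime) (hp2 : p ≠ 2) (hp7 : p ≠ 7) :
    ¬ p ∣ RingOfIntegers.exponent θint := by
  have hset : 14 ∈ {d : ℕ | 0 < d ∧ (d : 𝓞 K) ∈ conductor ℤ θint} :=
    ⟨by norm_num, by exact_mod_cast fourteen_mem_conductor⟩
  have hne : {d : ℕ | 0 < d ∧ (d : 𝓞 K) ∈ conductor ℤ θint}.Nonempty := ⟨14, hset⟩
  have hle : RingOfIntegers.exponent θint ≤ 14 := by
    rw [RingOfIntegers.exponent_eq_sInf]; exact Nat.sInf_le hset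
  have hmem : RingOfIntegers.exponent θint ∈ {d : ℕ | 0 < d ∧ (d : 𝓞 K) ∈ conductor ℤ θint} := by
    rw [RingOfIntegers.exponent_eq_sInf]; exact Nat.sInf_mem hne
  have hpos : 0 < RingOfIntegers.exponent θint := hmem.1
  have h14 : 14 ∣ RingOfIntegers.exponent θint := dvd_of_natCast_mem_conductor hmem.2
  have heq : RingOfIntegers.exponent θint = 14 :=
    le_antisymm hle (Nat.le_of_dvd hpos h14)
  rw [heq]
  intro h
  have h' : p ∣ 2 * 7 := h
  rcases (Nat.Prime.dvd_mul hp).mp h' with h2 | h7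
  · exact hp2 ((Nat.prime_dvd_prime_iff_eq hp Nat.prime_two).mp h2)
  · exact hp7 ((Nat.prime_dvd_prime_iff_eq hp (by norm_num)).mp h7)

/-! ### Dedekind–Kummer away from `14` -/

/-- The reduction of `f'` modulo `p`. [folklore] -/
def cubicPolyMod (p : ℕ) : (ZMod p)[X] := cubicPoly.map (Int.castRingHom (ZMod p))

/-- `f' mod p` is monic. [folklore] -/
theorem monic_cubicPolyMod (p : ℕ) [Fact p.Prime] : (cubicPolyMod p).Monic := cubicPoly_monic.map _

/-- `f' mod p` has degree `3`. [folklore] -/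
theorem natDegree_cubicPolyMod (p : ℕ) [Fact p.Prime] : (cubicPolyMod p).natDegree = 3 := by
  rw [cubicPolyMod, cubicPoly_monic.natDegree_map, cubicPoly_natDegree]

/-- Evaluation of `f' mod p`. [folklore] -/
theorem eval_cubicPolyMod (p : ℕ) (c : ZMod p) : (cubicPolyMod p).eval c = c ^ 3 + c ^ 2 - 446 * c + 248 := by
  simp [cubicPolyMod, cubicPoly]

/-- `f' mod p` written out. [folklore] -/
theorem cubicPolyMod_eq (p : ℕ) : cubicPolyMod p = X ^ 3 + X ^ 2 - C (446 : ZMod p) * X + C 248 := by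
  rw [cubicPolyMod, cubicPoly, Polynomial.map_add, Polynomial.map_sub, Polynomial.map_add,
    Polynomial.map_pow, Polynomial.map_pow, map_X, Polynomial.map_mul, Polynomial.map_C,
    Polynomial.map_C, map_X, show (Int.castRingHom (ZMod p)) 446 = 446 from map_ofNat _ _,
    show (Int.castRingHom (ZMod p)) 248 = 248 from map_ofNat _ _]

/-- `minpoly_ℤ θint = f'`. [folklore] -/
theorem minpoly_θint : minpoly ℤ θint = cubicPoly := by
  rw [← RingOfIntegers.minpoly_coe, coe_θint]
  convert minpoly_int_θ
  exact Subsingleton.elim _ _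

/-- **Dedekind–Kummer at `p ∉ {2, 7}`**: a prime `P` of `𝓞 K` above `p` is `(p, Q(θ))` for any
integer lift `Q` of the corresponding monic irreducible factor of `f' mod p`, of residue degree its
degree. [folklore] -/
theorem exists_factor_of_mem_primesOver {p : ℕ} (hp : p.Prime) (hp2 : p ≠ 2) (hp7 : p ≠ 7)
    {P : Ideal (𝓞 K)} (hP : P ∈ primesOver (span {(p : ℤ)}) (𝓞 K)) :
    ∃ Qb : (ZMod p)[X], Irreducible Qb ∧ Qb.Monic ∧ Qb ∣ cubicPolyMod p ∧
      P.inertiaDeg ℤ = Qb.natDegree ∧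
      ∀ Q : ℤ[X], Q.map (Int.castRingHom (ZMod p)) = Qb → P = span {(p : 𝓞 K), aeval θint Q} := by
  haveI := Fact.mk hp
  have hexp : ¬ p ∣ RingOfIntegers.exponent θint := not_dvd_exponent hp hp2 hp7
  set e := NumberField.Ideal.primesOverSpanEquivMonicFactorsMod (K := K) hexp with he
  set Qb := e ⟨P, hP⟩ with hQb
  have hmem : (Qb : (ZMod p)[X]) ∈ RingOfIntegers.monicFactorsMod θint p := Qb.2
  have hmem' := hmem
  simp only [RingOfIntegers.monicFactorsMod, Multiset.mem_toFinset, minpoly_θint] at hmem'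
  have h0 : cubicPolyMod p ≠ 0 := (monic_cubicPolyMod p).ne_zero
  obtain ⟨hirr, hmon, hdvd⟩ := (Polynomial.mem_normalizedFactors_iff h0).mp hmem'
  refine ⟨Qb, hirr, hmon, hdvd, ?_, ?_⟩
  · have := NumberField.Ideal.inertiaDeg_primesOverSpanEquivMonicFactorsMod_symm_apply' hexp hmem
    rwa [show (⟨(Qb : (ZMod p)[X]), hmem⟩ : RingOfIntegers.monicFactorsMod θint p) = Qb
      from Subtype.ext rfl, Equiv.symm_apply_apply] at this
  · intro Q hQ
    have hmemQ : Q.map (Int.castRingHom (ZMod p)) ∈ RingOfIntegers.monicFactorsMod θint p := hQ ▸ hmem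
    have h1 := NumberField.Ideal.primesOverSpanEquivMonicFactorsMod_symm_apply_eq_span hexp hmemQ
    have h2 : (⟨Q.map (Int.castRingHom (ZMod p)), hmemQ⟩ :
        RingOfIntegers.monicFactorsMod θint p) = Qb := Subtype.ext hQ
    rw [h2, hQb, Equiv.symm_apply_apply] at h1
    exact h1

/-- **Inert primes**: if `p ∉ {2, 7}` and `f'` has no root modulo `p`, every prime above `p` is `(p)`,
of residue degree `3`. [folklore] -/
theorem eq_span_of_no_root {p : ℕ} (hp : p.Prime) (hp2 : p ≠ 2) (hp7 : p ≠ 7) {P : Ideal (𝓞 K)}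
    (hP : P ∈ primesOver (span {(p : ℤ)}) (𝓞 K))
    (hnr : ∀ c : ZMod p, c ^ 3 + c ^ 2 - 446 * c + 248 ≠ 0) :
    P = span {(p : 𝓞 K)} ∧ P.inertiaDeg ℤ = 3 := by
  haveI := Fact.mk hp
  obtain ⟨Qb, hirr, hmon, hdvd, hdeg, hspan⟩ := exists_factor_of_mem_primesOver hp hp2 hp7 hP
  have hfirr : Irreducible (cubicPolyMod p) := by
    refine irreducible_of_degree_le_three_of_not_isRoot
      (by rw [natDegree_cubicPolyMod]; decide) fun c hc => hnr c ?_
    rwa [IsRoot.def, eval_cubicPolyMod] at hc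
  have hQb : Qb = cubicPolyMod p :=
    eq_of_monic_of_associated hmon (monic_cubicPolyMod p) (hirr.associated_of_dvd hfirr hdvd)
  refine ⟨?_, by rw [hdeg, hQb, natDegree_cubicPolyMod]⟩
  have h := hspan cubicPoly (by rw [hQb]; rfl)
  rw [aeval_θint] at h
  rw [h, Ideal.span_insert, Ideal.span_singleton_eq_bot.mpr rfl, sup_bot_eq]

/-- `f'` has no root modulo `3, 5` (these primes are inert). [folklore] -/
theorem no_root :
    (∀ c : ZMod 3, c ^ 3 + c ^ 2 - 446 * c + 248 ≠ 0) ∧ (∀ c : ZMod 5, c ^ 3 + c ^ 2 - 446 * c + 248 ≠ 0) := by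
  refine ⟨by decide, by decide⟩

/-- A prime `P` of `𝓞 K` containing the rational prime `p` lies over `(p) ⊂ ℤ`. [folklore] -/
theorem mem_primesOver_of_mem {p : ℕ} (hp : p.Prime) {P : Ideal (𝓞 K)} [hP : P.IsPrime]
    (hmem : (p : 𝓞 K) ∈ P) : P ∈ primesOver (span {(p : ℤ)}) (𝓞 K) := by
  haveI : Fact p.Prime := ⟨hp⟩
  refine ⟨hP, ⟨?_⟩⟩
  refine (Int.ideal_span_isMaximal_of_prime p).eq_of_le (Ideal.comap_ne_top _ hP.ne_top) ?_
  rw [Ideal.span_singleton_le_iff_mem, Ideal.mem_comap, map_natCast]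
  exact hmem

/-- A prime of `𝓞 K` above the rational prime `p` contains `p`. [folklore] -/
theorem natCast_mem_of_mem_primesOver {p : ℕ} {P : Ideal (𝓞 K)}
    (hP : P ∈ primesOver (span {(p : ℤ)}) (𝓞 K)) : (p : 𝓞 K) ∈ P := by
  have h : ((p : ℤ) : 𝓞 K) ∈ P := by
    have hu : (p : ℤ) ∈ P.under ℤ := by rw [← hP.2.over]; exact Ideal.mem_span_singleton_self _
    exact hu
  simpa using h

/-- **The inert primes `p = 3, 5`**: `(p)` is prime of residue degree `3` and is the only prime above
`p`. [folklore] -/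
theorem span_inert {p : ℕ} (hp : p = 3 ∨ p = 5) :
    (span {(p : 𝓞 K)}).IsPrime ∧ (span {(p : 𝓞 K)}).inertiaDeg ℤ = 3 ∧
      ∀ P ∈ primesOver (span {(p : ℤ)}) (𝓞 K), P = span {(p : 𝓞 K)} := by
  have hprime : p.Prime := by rcases hp with rfl | rfl <;> norm_num
  have hp2 : p ≠ 2 := by rcases hp with rfl | rfl <;> norm_num
  have hp7 : p ≠ 7 := by rcases hp with rfl | rfl <;> norm_num
  have hnr : ∀ c : ZMod p, c ^ 3 + c ^ 2 - 446 * c + 248 ≠ 0 := by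
    obtain ⟨n3, n5⟩ := no_root
    rcases hp with rfl | rfl
    exacts [n3, n5]
  have hall : ∀ P ∈ primesOver (span {(p : ℤ)}) (𝓞 K), P = span {(p : 𝓞 K)} ∧ P.inertiaDeg ℤ = 3 :=
    fun P hP => eq_span_of_no_root hprime hp2 hp7 hP hnr
  haveI : Fact (Nat.Prime p) := ⟨hprime⟩
  haveI : (span {(p : ℤ)}).IsPrime := (Int.ideal_span_isMaximal_of_prime p).isPrime
  obtain ⟨⟨P, hP⟩⟩ := Ideal.nonempty_primesOver (S := 𝓞 K) (span {(p : ℤ)})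
  obtain ⟨hPeq, hdeg⟩ := hall P hP
  subst hPeq
  exact ⟨hP.1, hdeg, fun Q hQ => (hall Q hQ).1⟩

/-! ### The prime ideals `𝔭 = ker(ψ_{p,t,v})` -/

/-- An admissible pair of images modulo `p` gives images in `ℤ/p` satisfying the relations. [folklore] -/
theorem rels_zmod {p : ℕ} {t v : ℤ}
    (h : ((t * t + 4 + 9 * t - 14 * v : ℤ) : ZMod p) = 0 ∧ ((t * v + 20 - 27 * t - 8 * v : ℤ) : ZMod p) = 0 ∧
      ((v * v + 32 - 14 * t - 37 * v : ℤ) : ZMod p) = 0) :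
    (t : ZMod p) ^ 2 = -4 - 9 * (t : ZMod p) + 14 * (v : ZMod p) ∧
    (t : ZMod p) * (v : ZMod p) = -20 + 27 * (t : ZMod p) + 8 * (v : ZMod p) ∧
    (v : ZMod p) ^ 2 = -32 + 14 * (t : ZMod p) + 37 * (v : ZMod p) := by
  obtain ⟨h1, h2, h3⟩ := h
  push_cast at h1 h2 h3
  exact ⟨by linear_combination h1, by linear_combination h2, by linear_combination h3⟩

/-- **The residue map `ψ_{p,t,v} : 𝓞 K → ℤ/p`, `θ ↦ t`, `w ↦ v`**, for an admissible pair `(t, v)`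
(the three relations of the integral basis hold modulo `p`). [folklore] -/
def ψ (p : ℕ) (t v : ℤ)
    (h : ((t * t + 4 + 9 * t - 14 * v : ℤ) : ZMod p) = 0 ∧ ((t * v + 20 - 27 * t - 8 * v : ℤ) : ZMod p) = 0 ∧
      ((v * v + 32 - 14 * t - 37 * v : ℤ) : ZMod p) = 0) : 𝓞 K →+* ZMod p :=
  ringHomOfImages (t : ZMod p) (v : ZMod p) (rels_zmod h).1 (rels_zmod h).2.1 (rels_zmod h).2.2

section Pfacts

variable {p : ℕ} {t v : ℤ}
  (h : ((t * t + 4 + 9 * t - 14 * v : ℤ) : ZMod p) = 0 ∧ ((t * v + 20 - 27 * t - 8 * v : ℤ) : ZMod p) = 0 ∧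
    ((v * v + 32 - 14 * t - 37 * v : ℤ) : ZMod p) = 0)
include h

/-- `ψ_{p,t,v}(θ) = t`. [folklore] -/
@[simp] theorem ψ_θint : ψ p t v h θint = (t : ZMod p) := ringHomOfImages_θint _ _ _ _ _

/-- `ψ_{p,t,v}(w) = v`. [folklore] -/
@[simp] theorem ψ_wint : ψ p t v h wint = (v : ZMod p) := ringHomOfImages_wint _ _ _ _ _

/-- `ψ_{p,t,v}` is surjective. [folklore] -/
theorem ψ_surjective [Fact p.Prime] : Function.Surjective (ψ p t v h) := ZMod.ringHom_surjective _

/-- **The prime ideal `𝔭_{p,t,v} = ker ψ_{p,t,v}`.** [folklore] -/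
def P : Ideal (𝓞 K) := RingHom.ker (ψ p t v h)

/-- Membership in `𝔭_{p,t,v}` is the vanishing of `ψ_{p,t,v}` (decidable on explicit elements).
[folklore] -/
theorem mem_P_iff {x : 𝓞 K} : x ∈ P h ↔ ψ p t v h x = 0 := RingHom.mem_ker

/-- `𝔭_{p,t,v}` is maximal. [folklore] -/
theorem isMaximal_P [Fact p.Prime] : (P h).IsMaximal :=
  RingHom.ker_isMaximal_of_surjective _ (ψ_surjective h)

/-- **`N(𝔭_{p,t,v}) = p`** (`𝓞 K/𝔭 ≅ ℤ/p`). [folklore] -/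
theorem absNorm_P [Fact p.Prime] : absNorm (P h) = p := by
  have e := RingHom.quotientKerEquivOfSurjective (ψ_surjective h)
  rw [P, Ideal.absNorm_apply, Submodule.cardQuot_apply, Nat.card_congr e.toEquiv, Nat.card_zmod]

/-- `𝔭_{p,t,v} ≠ 0`. [folklore] -/
theorem P_ne_bot [Fact p.Prime] : P h ≠ ⊥ := by
  intro h0
  have := absNorm_P h
  rw [h0, Ideal.absNorm_bot] at this
  exact (Fact.out : p.Prime).ne_zero this.symm

/-- `p ∈ 𝔭_{p,t,v}`. [folklore] -/
theorem natCast_mem_P : (p : 𝓞 K) ∈ P h := by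
  rw [mem_P_iff, map_natCast, ZMod.natCast_self]

/-- `θ - t ∈ 𝔭_{p,t,v}`. [folklore] -/
theorem θint_sub_mem_P : (θint - t : 𝓞 K) ∈ P h := by
  rw [mem_P_iff, map_sub, ψ_θint, map_intCast, sub_self]

/-- `𝔭_{p,t,v}` lies over `p`. [folklore] -/
theorem P_mem_primesOver [Fact p.Prime] : P h ∈ primesOver (span {(p : ℤ)}) (𝓞 K) := by
  haveI := (isMaximal_P h).isPrime
  exact mem_primesOver_of_mem (Fact.out) (natCast_mem_P h)

/-- The image under `ψ_{p,t,v}` of an explicit element `a + bθ + cw`. [folklore] -/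
theorem ψ_lin (a b c : ℤ) :
    ψ p t v h (((a : 𝓞 K) + (b : 𝓞 K) * θint + (c : 𝓞 K) * wint : 𝓞 K)) = ((a + b * t + c * v : ℤ) : ZMod p) := by
  simp only [map_add, map_mul, map_intCast, ψ_θint, ψ_wint]
  push_cast
  ring

/-- **Membership test**: `a + bθ + cw ∈ 𝔭_{p,t,v}` iff `a + bt + cv ≡ 0 (mod p)`. [folklore] -/
theorem lin_mem_P {a b c : ℤ} (habc : ((a + b * t + c * v : ℤ) : ZMod p) = 0) :
    (((a : 𝓞 K) + (b : 𝓞 K) * θint + (c : 𝓞 K) * wint : 𝓞 K)) ∈ P h := by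
  rw [mem_P_iff, ψ_lin, habc]

end Pfacts

/-- **Distinct image pairs give distinct primes.** [folklore] -/
theorem P_ne_P {p : ℕ} {t v t' v' : ℤ}
    (h : ((t * t + 4 + 9 * t - 14 * v : ℤ) : ZMod p) = 0 ∧ ((t * v + 20 - 27 * t - 8 * v : ℤ) : ZMod p) = 0 ∧
      ((v * v + 32 - 14 * t - 37 * v : ℤ) : ZMod p) = 0)
    (h' : ((t' * t' + 4 + 9 * t' - 14 * v' : ℤ) : ZMod p) = 0 ∧
      ((t' * v' + 20 - 27 * t' - 8 * v' : ℤ) : ZMod p) = 0 ∧ ((v' * v' + 32 - 14 * t' - 37 * v' : ℤ) : ZMod p) = 0)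
    (hne : ((t' - t : ℤ) : ZMod p) ≠ 0 ∨ ((v' - v : ℤ) : ZMod p) ≠ 0) : P h ≠ P h' := by
  intro heq
  rcases hne with hne | hne
  · have hmem : (θint - t' : 𝓞 K) ∈ P h := by rw [heq]; exact θint_sub_mem_P h'
    rw [mem_P_iff, map_sub, ψ_θint, map_intCast] at hmem
    apply hne
    push_cast
    linear_combination -hmem
  · have hmem : (wint - v' : 𝓞 K) ∈ P h := by
      rw [heq, mem_P_iff, map_sub, ψ_wint, map_intCast, sub_self]
    rw [mem_P_iff, map_sub, ψ_wint, map_intCast] at hmem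
    apply hne
    push_cast
    linear_combination -hmem

/-- **Primes above different rational primes are distinct.** [folklore] -/
theorem P_ne_P' {p q : ℕ} {t v t' v' : ℤ}
    (h : ((t * t + 4 + 9 * t - 14 * v : ℤ) : ZMod p) = 0 ∧ ((t * v + 20 - 27 * t - 8 * v : ℤ) : ZMod p) = 0 ∧
      ((v * v + 32 - 14 * t - 37 * v : ℤ) : ZMod p) = 0)
    (h' : ((t' * t' + 4 + 9 * t' - 14 * v' : ℤ) : ZMod q) = 0 ∧
      ((t' * v' + 20 - 27 * t' - 8 * v' : ℤ) : ZMod q) = 0 ∧ ((v' * v' + 32 - 14 * t' - 37 * v' : ℤ) : ZMod q) = 0)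
    (hpq : ((p : ℕ) : ZMod q) ≠ 0) : P h ≠ P h' := by
  intro heq
  have hmem : (p : 𝓞 K) ∈ P h' := by rw [← heq]; exact natCast_mem_P h
  rw [mem_P_iff, map_natCast] at hmem
  exact hpq hmem

/-! ### Norms of explicit elements and certified factorisations -/

/-- **The integer norm form** of `a + bθ + cw`. [folklore] -/
def normForm (a b c : ℤ) : ℤ :=
  a ^ 3 - a ^ 2 * b + 64 * a ^ 2 * c - 446 * a * b ^ 2 - 489 * a * b * c + 919 * a * c ^ 2
    - 248 * b ^ 3 - 588 * b ^ 2 * c + 140 * b * c ^ 2 + 584 * c ^ 3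

/-- `N(a + bθ + cw) = normForm a b c`. [folklore] -/
theorem norm_lin (a b c : ℤ) :
    Algebra.norm ℤ (((a : 𝓞 K) + (b : 𝓞 K) * θint + (c : 𝓞 K) * wint : 𝓞 K)) = normForm a b c := by
  have h := Algebra.coe_norm_int (((a : 𝓞 K) + (b : 𝓞 K) * θint + (c : 𝓞 K) * wint : 𝓞 K))
  have hK : (((a : 𝓞 K) + (b : 𝓞 K) * θint + (c : 𝓞 K) * wint : 𝓞 K) : K) =
      ((c / 14 : ℚ) : K) * θ ^ 2 + ((b + 9 * c / 14 : ℚ) : K) * θ + ((a + 4 * c / 14 : ℚ) : K) := by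
    simp only [map_add, map_mul, map_intCast, coe_θint, coe_wint]
    rw [show w = (θ ^ 2 + 9 * θ + 4) / 14 from rfl]
    push_cast; ring
  rw [hK, norm_quadratic] at h
  have h' : ((Algebra.norm ℤ (((a : 𝓞 K) + (b : 𝓞 K) * θint + (c : 𝓞 K) * wint : 𝓞 K)) : ℤ) : ℚ) =
      ((normForm a b c : ℤ) : ℚ) := by
    rw [h, normForm]; push_cast; ring
  exact_mod_cast h'

/-- **`N((a + bθ + cw)) = |normForm a b c|`.** [folklore] -/
theorem absNorm_span_lin (a b c : ℤ) :
    absNorm (span {((a : 𝓞 K) + (b : 𝓞 K) * θint + (c : 𝓞 K) * wint : 𝓞 K)}) = (normForm a b c).natAbs := by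
  rw [absNorm_span_singleton, norm_lin]

/-- Two ideals `I ≤ J` of equal non-zero norm are equal. [folklore] -/
theorem eq_of_le_of_absNorm_eq {I J : Ideal (𝓞 K)} (hle : I ≤ J) (hN : absNorm I = absNorm J)
    (h0 : absNorm I ≠ 0) : I = J := by
  obtain ⟨L, hL⟩ := Ideal.dvd_iff_le.mpr hle
  have hmul : absNorm I = absNorm J * absNorm L := by rw [hL, map_mul]
  rw [hN] at hmul h0
  have hJ0 : absNorm J ≠ 0 := fun h => h0 (by rw [h])
  have hL1 : absNorm L = 1 := mul_left_cancel₀ hJ0 (hmul.symm.trans (mul_one _).symm)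
  rw [Ideal.absNorm_eq_one_iff] at hL1
  rw [hL, hL1, Ideal.mul_top]

/-- The product of three pairwise comaximal ideals is their intersection. [folklore] -/
theorem mul₃_eq_inf {P₁ P₂ P₃ : Ideal (𝓞 K)} (h₁ : P₁.IsMaximal) (h₂ : P₂.IsMaximal) (h₃ : P₃.IsMaximal)
    (h₁₂ : P₁ ≠ P₂) (h₁₃ : P₁ ≠ P₃) (h₂₃ : P₂ ≠ P₃) : P₁ * P₂ * P₃ = P₁ ⊓ P₂ ⊓ P₃ := by
  have c₁₂ : IsCoprime P₁ P₂ := (Ideal.isCoprime_iff_sup_eq.mpr (h₁.coprime_of_ne h₂ h₁₂))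
  have c₁₃ : IsCoprime P₁ P₃ := (Ideal.isCoprime_iff_sup_eq.mpr (h₁.coprime_of_ne h₃ h₁₃))
  have c₂₃ : IsCoprime P₂ P₃ := (Ideal.isCoprime_iff_sup_eq.mpr (h₂.coprime_of_ne h₃ h₂₃))
  rw [Ideal.mul_eq_inf_of_isCoprime (c₁₃.mul_left c₂₃), Ideal.mul_eq_inf_of_isCoprime c₁₂]

/-- **Certified factorisation into three distinct primes**: if `x ∈ 𝔭₁, 𝔭₂, 𝔭₃` (pairwise distinct
maximal ideals) and `N((x)) = N(𝔭₁)N(𝔭₂)N(𝔭₃) ≠ 0`, then `(x) = 𝔭₁𝔭₂𝔭₃`. [folklore] -/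
theorem span_singleton_eq_mul₃ {x : 𝓞 K} {P₁ P₂ P₃ : Ideal (𝓞 K)} (h₁ : P₁.IsMaximal) (h₂ : P₂.IsMaximal)
    (h₃ : P₃.IsMaximal) (h₁₂ : P₁ ≠ P₂) (h₁₃ : P₁ ≠ P₃) (h₂₃ : P₂ ≠ P₃)
    (hx₁ : x ∈ P₁) (hx₂ : x ∈ P₂) (hx₃ : x ∈ P₃)
    (hN : absNorm (span {x}) = absNorm P₁ * absNorm P₂ * absNorm P₃) (hN0 : absNorm (span {x}) ≠ 0) :
    span {x} = P₁ * P₂ * P₃ := by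
  have hle : span {x} ≤ P₁ * P₂ * P₃ := by
    rw [mul₃_eq_inf h₁ h₂ h₃ h₁₂ h₁₃ h₂₃, span_singleton_le_iff_mem]
    exact ⟨⟨hx₁, hx₂⟩, hx₃⟩
  refine eq_of_le_of_absNorm_eq hle ?_ hN0
  rw [hN, map_mul, map_mul]

/-- Certified factorisation into two distinct primes. [folklore] -/
theorem span_singleton_eq_mul₂ {x : 𝓞 K} {P₁ P₂ : Ideal (𝓞 K)} (h₁ : P₁.IsMaximal) (h₂ : P₂.IsMaximal)
    (h₁₂ : P₁ ≠ P₂) (hx₁ : x ∈ P₁) (hx₂ : x ∈ P₂)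
    (hN : absNorm (span {x}) = absNorm P₁ * absNorm P₂) (hN0 : absNorm (span {x}) ≠ 0) :
    span {x} = P₁ * P₂ := by
  have c₁₂ : IsCoprime P₁ P₂ := (Ideal.isCoprime_iff_sup_eq.mpr (h₁.coprime_of_ne h₂ h₁₂))
  have hle : span {x} ≤ P₁ * P₂ := by
    rw [Ideal.mul_eq_inf_of_isCoprime c₁₂, span_singleton_le_iff_mem]
    exact ⟨hx₁, hx₂⟩
  refine eq_of_le_of_absNorm_eq hle ?_ hN0
  rw [hN, map_mul]

/-- Certified principal prime: `x ∈ 𝔭` with `N((x)) = N(𝔭) ≠ 0` gives `(x) = 𝔭`. [folklore] -/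
theorem span_singleton_eq_of_mem {x : 𝓞 K} {P₁ : Ideal (𝓞 K)} (hx₁ : x ∈ P₁)
    (hN : absNorm (span {x}) = absNorm P₁) (hN0 : absNorm (span {x}) ≠ 0) : span {x} = P₁ :=
  eq_of_le_of_absNorm_eq ((span_singleton_le_iff_mem _).mpr hx₁) hN hN0

/-! ### Split primes: the three listed primes are all the primes above `p` -/

/-- `N((p)) = p³` for a natural number `p`. [folklore] -/
theorem absNorm_span_natCast (p : ℕ) : absNorm (span {(p : 𝓞 K)}) = p ^ 3 := by
  rw [absNorm_span_singleton, show (p : 𝓞 K) = algebraMap ℤ (𝓞 K) p by simp, Algebra.norm_algebraMap,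
    NumberField.RingOfIntegers.rank, finrank_K]
  simp [Int.natAbs_pow]

/-- **At a split prime the three explicit primes exhaust the primes above `p`**: if `𝔭₁, 𝔭₂, 𝔭₃` are
pairwise distinct maximal ideals of norm `p` containing `p`, then `(p) = 𝔭₁𝔭₂𝔭₃` (inclusion and
equal norms `p³`), so every prime above `p` contains, hence equals, one of them. This needs no
Dedekind–Kummer and covers `p = 2, 7` (which divide the index `[𝓞 K : ℤ[θ]] = 14`). [folklore] -/
theorem eq_of_mem_primesOver_split {p : ℕ} (hp : p.Prime) {P₁ P₂ P₃ : Ideal (𝓞 K)}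
    (h₁ : P₁.IsMaximal) (h₂ : P₂.IsMaximal) (h₃ : P₃.IsMaximal) (h₁₂ : P₁ ≠ P₂) (h₁₃ : P₁ ≠ P₃)
    (h₂₃ : P₂ ≠ P₃) (hm₁ : (p : 𝓞 K) ∈ P₁) (hm₂ : (p : 𝓞 K) ∈ P₂) (hm₃ : (p : 𝓞 K) ∈ P₃)
    (hN₁ : absNorm P₁ = p) (hN₂ : absNorm P₂ = p) (hN₃ : absNorm P₃ = p)
    {Q : Ideal (𝓞 K)} (hQ : Q ∈ primesOver (span {(p : ℤ)}) (𝓞 K)) : Q = P₁ ∨ Q = P₂ ∨ Q = P₃ := by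
  have hprod : span {(p : 𝓞 K)} = P₁ * P₂ * P₃ := by
    refine eq_of_le_of_absNorm_eq ?_ ?_ ?_
    · rw [mul₃_eq_inf h₁ h₂ h₃ h₁₂ h₁₃ h₂₃, span_singleton_le_iff_mem]
      exact ⟨⟨hm₁, hm₂⟩, hm₃⟩
    · rw [absNorm_span_natCast, map_mul, map_mul, hN₁, hN₂, hN₃]; ring
    · rw [absNorm_span_natCast]; exact pow_ne_zero 3 hp.ne_zero
  haveI := hQ.1
  have hQle : P₁ * P₂ * P₃ ≤ Q := by
    rw [← hprod, span_singleton_le_iff_mem]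
    exact natCast_mem_of_mem_primesOver hQ
  have hQtop : Q ≠ ⊤ := hQ.1.ne_top
  rcases (Ideal.IsPrime.mul_le hQ.1).mp hQle with h12 | h3'
  · rcases (Ideal.IsPrime.mul_le hQ.1).mp h12 with h1' | h2'
    · exact Or.inl (h₁.eq_of_le hQtop h1').symm
    · exact Or.inr (Or.inl (h₂.eq_of_le hQtop h2').symm)
  · exact Or.inr (Or.inr (h₃.eq_of_le hQtop h3').symm)

/-! ### Totally ramified primes: `f' ≡ (X - m)³ (mod p)` -/

/-- **`f' ≡ (X - m)³ (mod p)` from the congruences** `3m ≡ -1`, `3m² ≡ -446`, `m³ ≡ -248`. [folklore] -/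
theorem cubicPolyMod_eq_cube {p : ℕ} {m : ℤ} (h1 : ((3 * m + 1 : ℤ) : ZMod p) = 0)
    (h2 : ((3 * m ^ 2 + 446 : ℤ) : ZMod p) = 0) (h3 : ((m ^ 3 + 248 : ℤ) : ZMod p) = 0) :
    cubicPolyMod p = (X - C (m : ZMod p)) ^ 3 := by
  push_cast at h1 h2 h3
  have e1 : (3 * (m : ZMod p)) = -1 := by linear_combination h1
  have e2 : (3 * (m : ZMod p) ^ 2) = -446 := by linear_combination h2
  have e3 : ((m : ZMod p) ^ 3) = -248 := by linear_combination h3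
  rw [cubicPolyMod_eq]
  have : (X - C (m : ZMod p)) ^ 3 = X ^ 3 - C (3 * (m : ZMod p)) * X ^ 2 + C (3 * (m : ZMod p) ^ 2) * X
      - C ((m : ZMod p) ^ 3) := by
    simp only [map_mul, map_pow, map_ofNat]
    ring
  rw [this, e1, e2, e3, map_neg, map_neg, map_neg, map_one]
  ring

/-- **At a totally ramified `p ∉ {2, 7}` the explicit prime is the only prime above `p`**: by
Dedekind–Kummer the factor of a prime `Q` above `p` is `X - m`, so `Q = (p, θ - m) ⊆ 𝔭_{p,m,v}`,
and `Q` is maximal. [folklore] -/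
theorem eq_P_of_cube {p : ℕ} (hp : p.Prime) (hp2 : p ≠ 2) (hp7 : p ≠ 7) {m v : ℤ}
    (hf : cubicPolyMod p = (X - C (m : ZMod p)) ^ 3)
    (h : ((m * m + 4 + 9 * m - 14 * v : ℤ) : ZMod p) = 0 ∧ ((m * v + 20 - 27 * m - 8 * v : ℤ) : ZMod p) = 0 ∧
      ((v * v + 32 - 14 * m - 37 * v : ℤ) : ZMod p) = 0)
    {Q : Ideal (𝓞 K)} (hQ : Q ∈ primesOver (span {(p : ℤ)}) (𝓞 K)) : Q = P h := by
  haveI : Fact (Nat.Prime p) := ⟨hp⟩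
  obtain ⟨Qb, hirr, hmon, hdvd, -, hspan⟩ := exists_factor_of_mem_primesOver hp hp2 hp7 hQ
  rw [hf] at hdvd
  have hQb : Qb = X - C (m : ZMod p) :=
    eq_of_monic_of_associated hmon (monic_X_sub_C _)
      (hirr.associated_of_dvd (irreducible_X_sub_C _) (hirr.prime.dvd_of_dvd_pow hdvd))
  haveI := hQ.1
  have hQmax : Q.IsMaximal := by
    refine hQ.1.isMaximal fun h0 => ?_
    have hmem := natCast_mem_of_mem_primesOver hQ
    rw [h0, Ideal.mem_bot] at hmem
    exact hp.ne_zero (by exact_mod_cast hmem)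
  have hs := hspan (X - C m) (by rw [Polynomial.map_sub, map_X, Polynomial.map_C, eq_intCast, hQb])
  rw [map_sub, aeval_X, aeval_C, algebraMap_int_eq, eq_intCast] at hs
  have hle : Q ≤ P h := by
    rw [hs, Ideal.span_le, Set.insert_subset_iff, Set.singleton_subset_iff]
    exact ⟨natCast_mem_P h, θint_sub_mem_P h⟩
  exact hQmax.eq_of_le (isMaximal_P h).ne_top hle

/-! ### The discriminant `d_K = 1339²` and the Minkowski bound -/

/-- The integral basis as a family. [folklore] -/
def intFamily : Fin 3 → 𝓞 K := ![1, θint, wint]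

/-- `1, θ, w` are linearly independent over `ℤ`. [folklore] -/
theorem linearIndependent_intFamily : LinearIndependent ℤ intFamily := by
  rw [Fintype.linearIndependent_iff]
  intro g hg i
  have h0 : ((g 0 : 𝓞 K) + g 1 * θint + g 2 * wint : 𝓞 K) = (0 : ℤ) + (0 : ℤ) * θint + (0 : ℤ) * wint := by
    rw [Fin.sum_univ_three] at hg
    simp only [intFamily, Matrix.cons_val_zero, Matrix.cons_val_one, Matrix.cons_val_two,
      Matrix.tail_cons, Matrix.head_cons, zsmul_eq_mul] at hg
    push_cast
    linear_combination hg
  have h2 := congrArg (fun x : 𝓞 K => (x : K)) h0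
  simp only [map_add, map_mul, map_intCast, coe_θint, coe_wint] at h2
  obtain ⟨ha, hb, hc⟩ := coords_unique h2
  fin_cases i
  exacts [ha, hb, hc]

/-- `1, θ, w` span `𝓞 K` over `ℤ`. [folklore] -/
theorem span_intFamily : ⊤ ≤ Submodule.span ℤ (Set.range intFamily) := by
  intro z _
  obtain ⟨a, b, c, rfl⟩ := exists_int_coords z
  have h0 : (1 : 𝓞 K) ∈ Submodule.span ℤ (Set.range intFamily) := Submodule.subset_span ⟨0, rfl⟩
  have h1 : (θint : 𝓞 K) ∈ Submodule.span ℤ (Set.range intFamily) := Submodule.subset_span ⟨1, rfl⟩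
  have h2 : (wint : 𝓞 K) ∈ Submodule.span ℤ (Set.range intFamily) := Submodule.subset_span ⟨2, rfl⟩
  have e : (a : 𝓞 K) + b * θint + c * wint = a • (1 : 𝓞 K) + b • θint + c • wint := by
    simp only [zsmul_eq_mul, mul_one]
  rw [e]
  exact Submodule.add_mem _ (Submodule.add_mem _ (Submodule.smul_mem _ _ h0)
    (Submodule.smul_mem _ _ h1)) (Submodule.smul_mem _ _ h2)

/-- **The integral basis `1, θ, w` of `𝓞 K`** as a `ℤ`-basis. [folklore] -/
def intBasis : Module.Basis (Fin 3) ℤ (𝓞 K) := Module.Basis.mk linearIndependent_intFamily span_intFamily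

/-- The elements of `intBasis` in `K`: `1, θ, w`. [folklore] -/
theorem intBasis_apply_coe (i : Fin 3) : ((intBasis i : 𝓞 K) : K) = ![(1 : K), θ, w] i := by
  rw [intBasis, Module.Basis.mk_apply]
  fin_cases i <;> simp [intFamily]

/-- The change of basis from `1, θ, θ²` to `1, θ, w` (determinant `1/14`). [folklore] -/
def changeMatrix : Matrix (Fin 3) (Fin 3) ℚ := !![1, 0, 2/7; 0, 1, 9/14; 0, 0, 1/14]

/-- `det changeMatrix = 1/14`. [folklore] -/
theorem det_changeMatrix : changeMatrix.det = 1 / 14 := by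
  simp [changeMatrix, Matrix.det_fin_three]

/-- `(1, θ, w) = (1, θ, θ²) · P`. [folklore] -/
theorem vecMul_changeMatrix :
    Matrix.vecMul (fun i : Fin 3 => pbθ.basis ((finCongr pbθ_dim).symm i))
      (changeMatrix.map (algebraMap ℚ K)) = ![(1 : K), θ, w] := by
  have hb : ∀ i : Fin 3, pbθ.basis ((finCongr pbθ_dim).symm i) = θ ^ (i : ℕ) := fun i => by
    rw [PowerBasis.coe_basis, pbθ_gen]; rfl
  ext j
  simp only [Matrix.vecMul, dotProduct, Fin.sum_univ_three, Matrix.map_apply, hb]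
  fin_cases j <;> simp [changeMatrix, show w = (θ ^ 2 + 9 * θ + 4) / 14 from rfl]
  ring

/-- **`d_K = 1792921 = 1339²`.** [folklore] -/
theorem discr_eq : NumberField.discr K = 1792921 := by
  classical
  apply (algebraMap ℤ ℚ).injective_int
  rw [← NumberField.discr_eq_discr _ intBasis, ← Algebra.discr_localizationLocalization ℤ
    (nonZeroDivisors ℤ) K]
  have hfam : ⇑(intBasis.localizationLocalization ℚ (nonZeroDivisors ℤ) K) = ![(1 : K), θ, w] := by
    ext i
    rw [Module.Basis.localizationLocalization_apply, ← intBasis_apply_coe]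
  rw [hfam, ← vecMul_changeMatrix, Algebra.discr_of_matrix_vecMul, det_changeMatrix]
  have hre : Algebra.discr ℚ (fun i : Fin 3 => pbθ.basis ((finCongr pbθ_dim).symm i)) =
      Algebra.discr ℚ pbθ.basis := by
    rw [← Algebra.discr_reindex ℚ pbθ.basis (finCongr pbθ_dim)]
    rfl
  rw [hre, discr_pbθ]
  norm_num

/-- `r₂ = 0`: `K` has three real embeddings. [folklore] -/
theorem nrComplexPlaces_eq_zero : InfinitePlace.nrComplexPlaces K = 0 := by
  have h1 := InfinitePlace.card_add_two_mul_card_eq_rank K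
  rw [finrank_K] at h1
  have hr : 3 ≤ InfinitePlace.nrRealPlaces K := by
    classical
    rw [← NumberField.InfinitePlace.card_real_embeddings]
    have hreal : ∀ e : K →+* ℝ, ComplexEmbedding.IsReal ((algebraMap ℝ ℂ).comp e) := fun e => by
      rw [ComplexEmbedding.isReal_iff]
      refine RingHom.ext fun x => ?_
      simp only [ComplexEmbedding.conjugate_coe_eq, RingHom.coe_comp, Function.comp_apply,
        Complex.coe_algebraMap, Complex.conj_ofReal]
    let emb : Fin 3 → {φ : K →+* ℂ // ComplexEmbedding.IsReal φ} :=
      ![⟨_, hreal e₁⟩, ⟨_, hreal e₂⟩, ⟨_, hreal e₃⟩]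
    have hval : ∀ i, (emb i).1 θ = ((![r₁, r₂, r₃] i : ℝ) : ℂ) := by
      intro i; fin_cases i <;> simp [emb]
    have hinj : Function.Injective emb := by
      intro i j hij
      have h := congrArg (fun φ : {φ : K →+* ℂ // ComplexEmbedding.IsReal φ} => φ.1 θ) hij
      simp only [hval, Complex.ofReal_inj] at h
      have h1 := r₁_spec.1; have h2 := r₂_spec.1; have h3 := r₃_spec.1
      simp only [Set.mem_Ioo] at h1 h2 h3
      fin_cases i <;> fin_cases j <;> simp at h ⊢ <;> linarith
    simpa using Fintype.card_le_of_injective emb hinj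
  omega

/-- **`⌊M_K⌋ ≤ 297`**: `M_K = (3!/3³) √1792921 = (6/27)·1339 < 298`. [folklore] -/
theorem floor_minkowskiBound_le :
    ⌊(4 / Real.pi) ^ InfinitePlace.nrComplexPlaces K *
        ((Module.finrank ℚ K).factorial / (Module.finrank ℚ K : ℝ) ^ Module.finrank ℚ K *
          Real.sqrt |(NumberField.discr K : ℝ)|)⌋₊ ≤ 297 := by
  have hsqrt : Real.sqrt |(NumberField.discr K : ℝ)| = 1339 := by
    rw [discr_eq, show ((1792921 : ℤ) : ℝ) = (1339 : ℝ) ^ 2 by norm_num, abs_of_nonneg (by positivity),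
      Real.sqrt_sq (by norm_num)]
  rw [finrank_K, hsqrt, nrComplexPlaces_eq_zero, pow_zero, one_mul]
  have hfac : ((3 : ℕ).factorial : ℝ) = 6 := by norm_num [Nat.factorial]
  rw [hfac]
  refine Nat.le_of_lt_succ ((Nat.floor_lt (by positivity)).mpr ?_)
  norm_num

/-- **Minkowski**: every ideal class of `K` contains an integral ideal of norm `≤ 297`. [folklore] -/
theorem exists_ideal_in_class_of_norm_le (c : ClassGroup (𝓞 K)) :
    ∃ I : (Ideal (𝓞 K))⁰, ClassGroup.mk0 I = c ∧ absNorm (I : Ideal (𝓞 K)) ≤ 297 := by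
  obtain ⟨I, hI, hle⟩ := NumberField.exists_ideal_in_class_of_norm_le c
  refine ⟨I, hI, ?_⟩
  have h := Nat.le_floor (α := ℝ) (n := absNorm (I : Ideal (𝓞 K))) hle
  exact h.trans floor_minkowskiBound_le

end CyclicCubic1339A

end Literature.NumberTheory.NumberFields

end
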